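import Literature.Probability.RandomPlanarGeometry.HexSAWStripBetaLengthWidthOne
import Literature.Probability.RandomPlanarGeometry.HexSAWStripMeanContacts
import HarnessLib

/-!
# The mean LENGTH of a critical strip β-walk diverges with a simple pole along the threshold ray: `(1 − t)·⟨|ω|/2⟩_t → 1` for every width
# `T ≥ 1` (module «BETA-MEAN-LENGTH»; the length twin of «MEAN-CONTACTS»)

Topic `Literature/Probability/RandomPlanarGeometry` (continues «BETA-LENGTH-WIDTH-ONE» `HexSAWStripBetaLengthWidthOne.lean` —
`HV.exists_pos_tendsto_betaLenSum_even_of_one_le`: for every `T ≥ 1`, `bℓ_T(2m)(y_T) → Λℓ_T > 0` and odd lengths are empty (#586 for `T ≥ 2`,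
width one explicit) —, «MEAN-CONTACTS» `HexSAWStripMeanContacts.lean` (the index-two Abelian lemma `HV.tendsto_one_sub_sq_mul_tsum`:
`q ≥ 0`, `q_m → Λ` ⇒ `(1 − s)² Σ_m m q_m s^m → Λ`), and the tree's Abelian theorem `Literature.Analysis.Asymptotics.hardyLittlewood_powerSeries_iff`
(easy direction, index one)).  Lane «pcv-sawmu» (CriticalPhenomena venture), a-p2 g22 — car 7 of the «β-walks by length» programme.  Sources of
the SETTING: N. R. Beaton et al., CMP 326 (2014) §2 eq. (10) (`x` conjugate to the length `|ω|`), §3.2, Corollary 8 (arXiv:1109.0358v5 p. 12: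
`ρ_T(y_T) = x_c`); W. Feller, vol. II (1971) XIII.5 Theorem 5 (Abelian theorems for power series).  Nothing of the kind is printed for the strip.

## The statement
Fix `T ≥ 1` and put `q_m := bℓ_T(2m)(y_T) = Σ_{β-walks of S_T with 2m vertices} x_c^{2m} y_T^{#top}` (#578 `HV.betaLenSum`).  Weighting every β-walk
of `S_T` by `(s x_c)^{|ω|} y_T^{c(ω)}` with `t = s² < 1` gives the partition function `Σ_m q_m t^m` and the MEAN HALF-LENGTH
`⟨m⟩_t := (Σ_m m q_m t^m)/(Σ_m q_m t^m)` (`|ω| = 2m`).  Then, as `t ↑ 1` (i.e. `x = s x_c ↑ x_c` at `y = y_T`):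
`(1 − t)·Σ_m q_m t^m → Λℓ_T`, `(1 − t)²·Σ_m m q_m t^m → Λℓ_T`, and ★★★ `(1 − t)·⟨m⟩_t → 1` — a simple pole in the length fugacity with the universal,
amplitude-free mean law, for EVERY width; the twin of `(y_T − y)·⟨contacts⟩ → y_T` («MEAN-CONTACTS» #546).

## What is proved (namespace `Literature.Probability.RandomPlanarGeometry.SAW.HV`)

* ★★ `exists_abelian_betaLenSum` (`T ≥ 1`) — `∃ Λ > 0`: `q_m → Λ`, `Σ_m q_m t^m` summable on `[0,1)`, `(1 − t)Σ_m q_m t^m → Λ` and `(1 − t)²Σ_m m q_m t^m → Λ`;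
* ★★★ `tendsto_one_sub_mul_meanHalfLength` (`T ≥ 1`) — `(1 − t)·⟨m⟩_t ⟶ 1` as `t ↑ 1`.

Label: LANE THEOREM (own result of lane «pcv-sawmu», a-p2 g22, 2026-08-26); corollary of #586/«WIDTH-ONE» by two Abelian lemmas of the tree.
NOT claimed: higher moments, rates, uniformity in `T`, the chain analogue.
-/

noncomputable section

open Finset Filter Topology Literature.Probability.LatticeModels Literature.Probability.Percolation

namespace Literature.Probability.RandomPlanarGeometry.SAW.HV

variable {T : ℕ}

/-- ★★ **The Abelian limits of the length series at the threshold** (`T ≥ 1`): with `q_m = bℓ_T(2m)(y_T)` there is `Λ > 0` (the length amplitude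
`Λℓ_T`) such that `q_m → Λ`, `Σ_m q_m t^m` converges for `0 ≤ t < 1`, `(1 − t)·Σ_m q_m t^m → Λ` and `(1 − t)²·Σ_m m q_m t^m → Λ` as `t ↑ 1`.
[cite: Feller1971, XIII.5 Theorem 5 (Abelian half); BeatonBousquetMelouDeGierDuminilCopinGuttmann2014, Corollary 8 (arXiv v5 p. 12: ρ_T(y_T) = x_c); lane «pcv-sawmu» a-p2 g22 — own] -/
theorem exists_abelian_betaLenSum (hT : 1 ≤ T) :
    ∃ Λ : ℝ, 0 < Λ ∧ Tendsto (fun m : ℕ => betaLenSum T (2 * m) (stripYT T)) atTop (𝓝 Λ) ∧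
      (∀ t : ℝ, 0 ≤ t → t < 1 → Summable fun m : ℕ => betaLenSum T (2 * m) (stripYT T) * t ^ m) ∧
      Tendsto (fun t : ℝ => (1 - t) * ∑' m : ℕ, betaLenSum T (2 * m) (stripYT T) * t ^ m) (𝓝[<] 1) (𝓝 Λ) ∧
      Tendsto (fun t : ℝ => (1 - t) ^ 2 * ∑' m : ℕ, (m : ℝ) * betaLenSum T (2 * m) (stripYT T) * t ^ m) (𝓝[<] 1) (𝓝 Λ) := by
  obtain ⟨Λ, hΛ, hlim, -⟩ := exists_pos_tendsto_betaLenSum_even_of_one_le hT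
  have hy : 0 ≤ stripYT T := (one_lt_stripYT hT).le.trans' zero_le_one
  set q : ℕ → ℝ := fun m => betaLenSum T (2 * m) (stripYT T) with hq
  have hq0 : ∀ m, 0 ≤ q m := fun m => (betaLenSum_noRenLen_nonneg hy (2 * m)).1
  have hces : Tendsto (fun n : ℕ => (∑ k ∈ Finset.range n, q k) / (n : ℝ) ^ (1 : ℝ)) atTop (𝓝 (Λ / Real.Gamma (1 + 1))) := by
    have h2 : Real.Gamma (1 + 1) = 1 := by norm_num [Real.Gamma_two]
    rw [h2, div_one]
    refine hlim.cesaro.congr fun n => ?_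
    rw [Real.rpow_one, div_eq_inv_mul]
  have hHL := (Literature.Analysis.Asymptotics.hardyLittlewood_powerSeries_iff hq0 zero_le_one hΛ).mpr hces
  refine ⟨Λ, hΛ, hlim, hHL.1, ?_, tendsto_one_sub_sq_mul_tsum hq0 hlim⟩
  refine hHL.2.congr fun t => ?_
  rw [Real.rpow_one]

/-- ★★★ **THE MEAN LENGTH OF A CRITICAL STRIP β-WALK HAS A SIMPLE POLE IN THE LENGTH FUGACITY, WITH THE UNIVERSAL MEAN LAW** (`T ≥ 1`):
with `⟨m⟩_t := (Σ_m m·bℓ_T(2m)(y_T) t^m)/(Σ_m bℓ_T(2m)(y_T) t^m)` the mean half-length of a β-walk of `S_T` weighted `(√t·x_c)^{|ω|} y_T^{c(ω)}`,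
`(1 − t) · ⟨m⟩_t ⟶ 1` as `t ↑ 1` (ratio of the index-two and index-one Abelian limits; the amplitude `Λℓ_T` cancels) — the length twin of
`(y_T − y)·⟨contacts⟩ → y_T` («MEAN-CONTACTS»), for every width.
[cite: BeatonBousquetMelouDeGierDuminilCopinGuttmann2014, §2 eq. (10) and Corollary 8 (arXiv v5 p. 12); Feller1971, XIII.5 Theorem 5; lane «pcv-sawmu» a-p2 g22 — own result] -/
theorem tendsto_one_sub_mul_meanHalfLength (hT : 1 ≤ T) :
    Tendsto (fun t : ℝ => (1 - t) * ((∑' m : ℕ, (m : ℝ) * betaLenSum T (2 * m) (stripYT T) * t ^ m) /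
      ∑' m : ℕ, betaLenSum T (2 * m) (stripYT T) * t ^ m)) (𝓝[<] 1) (𝓝 1) := by
  obtain ⟨Λ, hΛ, -, hsum, h1, h2⟩ := exists_abelian_betaLenSum hT
  have hy : 0 ≤ stripYT T := (one_lt_stripYT hT).le.trans' zero_le_one
  have h := h2.div h1 hΛ.ne'
  rw [div_self hΛ.ne'] at h
  refine h.congr' ?_
  have hev : ∀ᶠ t : ℝ in 𝓝[<] 1, 0 ≤ t := by
    have : Set.Ioo (0 : ℝ) 1 ∈ 𝓝[<] (1 : ℝ) := Ioo_mem_nhdsLT (by norm_num)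
    filter_upwards [this] with t ht using ht.1.le
  filter_upwards [hev, self_mem_nhdsWithin] with t ht0 ht1
  have hne : (1 : ℝ) - t ≠ 0 := (sub_pos.2 (Set.mem_Iio.1 ht1)).ne'
  simp only [Pi.div_apply]
  by_cases hB : ∑' m : ℕ, betaLenSum T (2 * m) (stripYT T) * t ^ m = 0
  · simp [hB]
  · field_simp

end Literature.Probability.RandomPlanarGeometry.SAW.HV
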